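import Summits.QuantumFields.YangMills.Theorems.ContinuumLimitOnTrajectory.Negative.WitnessRigidity
import Literature.MathematicalPhysics.QuantumLattice.SchwartzTranslationCutoff
import Literature.MathematicalPhysics.QuantumFieldTheory.OSSkeletonExplicitBounds
import HarnessLib

/-!
# `ContinuumLimitOnTrajectory` — negative-side support IX: no admissible pair of test functions may blow up;
# (A) is false modulo a kernel blow-up witness (the torus-seam misstatement, kernel-checked core)

Support file for crux `stmt-QuantumFields-10522` ((A) of `ParabolicTrajectory`), by the line lead (seat c4,
`prover-line-stmt-QuantumFields-10522-c4-0`). Tree objects only (`twoPointKernel`, `S2T`, `IsYangMillsFor`,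
`OSData.IsNontrivial`); the crux decl appears only as a HYPOTHESIS / negated conclusion.

## The finding it formalises
The torus-seam report (`Cruxes/ContinuumLimitOnTrajectory/SEAM-two-orbit-synchronisation.md`, seat c2): the crux's
hypothesis block bounds the torus half-side only through `a_k L_k → ∞`; along a slow-volume admissible scheme the
unit-normalised two-point kernel `K_k(f, g)` of the curvature field on a fat-tailed off-diagonal Schwartz pair picks up
the seam term `a_k⁻³ I_fg(ℓ_k) χ_k → ∞` (test-function tails wrapped around the periodic identification of opposite
faces of the smearing box `box 4 L_k`), while compactly supported pairs never touch the seam. This file proves the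
kernel-checked half of "hence (A) fails":

* `tendsto_S2T` — the truncated continuum two-point function `𝔖₂ᵀ(u ⊗ v)` is jointly continuous in the real
  profiles `(u, v)` (tensor continuity `continuous_tensorFin` + temperedness);
* `exists_compact_truncated_ne_zero_of_isNontrivial` — **non-triviality is witnessed by a COMPACTLY SUPPORTED real
  time-separated pair** (bump cut-offs `exists_tsupport_subset_inter_closedBall_tendsto`, Hörmander I Lemma 7.1.8,
  shrink supports, so time separation is kept);
* `continuumLimitOnTrajectory_imp_noKernelBlowUp` — **necessary condition (V) of (A)**: along every admissible
  sequence, if the unit-normalised kernels of all compactly supported time-separated real pairs stay bounded, then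
  the kernel of EVERY time-separated real Schwartz pair stays bounded (rigidity `tendsto_c_sq_mul_kernel`: the
  witness's `c_k²` is pinned below by a compact non-trivial pair, and `c_k² K_k(f,g)` must converge);
* `KernelBlowUp` — the hypothesis `H`: some admissible sequence (all of (A)'s hypotheses) has bounded kernels on
  compactly supported time-separated pairs but ONE time-separated Schwartz pair with `|K_k(f, g)| → ∞`;
* `continuumLimitOnTrajectory_false_of_kernelBlowUp : KernelBlowUp → ¬ ContinuumLimitOnTrajectory`.

`H` is what the SEAM note derives for every slow-volume admissible scheme from ONE physics input (the slab
susceptibility `χ_k ≳ β_k^{-2}`, cf. the disprover's `AdjacentCovLowerBound`/`PlaquetteCovNonneg` for the sibling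
crux `BalabanStepParabolic`, `Negative/FaceContact`) plus an a-priori bound on bulk pairs (`UVB`-type); it is not
constructible in the tree today because an admissible sequence is an instance of (S)+(B) at weak coupling (open) —
exactly as `Disproof.lean` §1 says any kill must be. Classification for the planner: refuted-MISSTATED modulo `H`;
repair = the volume-growth clause `∃ N ≥ 1, ∀ᶠ k, (a_k)⁻¹ ≤ (a_k L_k)^N` (under which no Schwartz pair sees the seam:
`…StubTransl`, `…TwoOrbitSynchronisation.PolyVolumeGrowth`), typed as `ContinuumLimitOnTrajectoryPVG` (…DefsF).
-/

namespace Summit.QuantumFields.YangMills.Theorems.ContinuumLimitOnTrajectory.Negative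

open MeasureTheory Filter Topology Complex
open scoped SchwartzMap
open Literature.MathematicalPhysics.QuantumFieldTheory Literature.MathematicalPhysics.QuantumLattice
open Literature.MathematicalPhysics.AQFT (IsOffDiagonal)
open Summit.QuantumFields.YangMills.Theses.ParabolicTrajectory (ContinuumLimitOnTrajectory)

noncomputable section

local notation "E⁴" => EuclideanSpace ℝ (Fin 4)

/-! ## §1 Continuity of the truncated two-point function in the profiles; compact witnesses -/

section Continuity

variable {ι : Type}

/-- The complexified real pair `(u, v) ↦ (ofRealTest u, ofRealTest v)` as a family `Fin 2 → 𝓢` is continuous.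
[folklore] -/
theorem continuous_pairFamily :
    Continuous fun p : 𝓢(E⁴, ℝ) × 𝓢(E⁴, ℝ) => fun i : Fin (1 + 1) => ofRealTest (![p.1, p.2] i) := by
  refine continuous_pi fun i => ?_
  fin_cases i
  · show Continuous fun p : 𝓢(E⁴, ℝ) × 𝓢(E⁴, ℝ) => ofRealTest p.1
    exact ofRealTest.continuous.comp continuous_fst
  · show Continuous fun p : 𝓢(E⁴, ℝ) × 𝓢(E⁴, ℝ) => ofRealTest p.2
    exact ofRealTest.continuous.comp continuous_snd

/-- **Joint continuity of the real product tensor** `(u, v) ↦ u ⊗ v`. [folklore] -/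
theorem continuous_T2 : Continuous fun p : 𝓢(E⁴, ℝ) × 𝓢(E⁴, ℝ) => T2 p.1 p.2 := by
  have h := (continuous_tensorFin (E' := E⁴) (1 + 1)).comp continuous_pairFamily
  exact h

/-- The one-variable family `u ↦ (ofRealTest u)` as `Fin 1 → 𝓢` is continuous. [folklore] -/
theorem continuous_oneFamily :
    Continuous fun u : 𝓢(E⁴, ℝ) => fun i : Fin 1 => ofRealTest (![u] i) := by
  refine continuous_pi fun i => ?_
  fin_cases i
  show Continuous fun u : 𝓢(E⁴, ℝ) => ofRealTest u
  exact ofRealTest.continuous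

/-- Continuity of the one-variable tensor `u ↦ T1 u`. [folklore] -/
theorem continuous_T1 : Continuous fun u : 𝓢(E⁴, ℝ) => T1 u := by
  have h := (continuous_tensorFin (E' := E⁴) 1).comp continuous_oneFamily
  exact h

/-- **The truncated continuum two-point function is jointly continuous in the real profiles** (temperedness of
`𝔖₂`, `𝔖₁` and tensor continuity). [folklore] -/
theorem continuous_S2T (T : OSData ι 4) (s : ι) :
    Continuous fun p : 𝓢(E⁴, ℝ) × 𝓢(E⁴, ℝ) => S2T T s p.1 p.2 := by
  have h2 : Continuous fun p : 𝓢(E⁴, ℝ) × 𝓢(E⁴, ℝ) => T.schwinger (1 + 1) (fun _ => s) (T2 p.1 p.2) :=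
    (T.schwinger (1 + 1) fun _ => s).continuous.comp continuous_T2
  have h1 : Continuous fun u : 𝓢(E⁴, ℝ) => T.schwinger 1 (fun _ => s) (T1 u) :=
    (T.schwinger 1 fun _ => s).continuous.comp continuous_T1
  have hu : Continuous fun p : 𝓢(E⁴, ℝ) × 𝓢(E⁴, ℝ) => T.schwinger 1 (fun _ => s) (T1 p.1) :=
    h1.comp continuous_fst
  have hv : Continuous fun p : 𝓢(E⁴, ℝ) × 𝓢(E⁴, ℝ) => T.schwinger 1 (fun _ => s) (T1 p.2) :=
    h1.comp continuous_snd
  exact h2.sub (hu.mul hv)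

/-- Sequential form: `𝔖₂ᵀ(uₘ ⊗ vₘ) → 𝔖₂ᵀ(u ⊗ v)` whenever `uₘ → u`, `vₘ → v` in `𝒮`. [folklore] -/
theorem tendsto_S2T (T : OSData ι 4) (s : ι) {u v : ℕ → 𝓢(E⁴, ℝ)} {u₀ v₀ : 𝓢(E⁴, ℝ)}
    (hu : Tendsto u atTop (𝓝 u₀)) (hv : Tendsto v atTop (𝓝 v₀)) :
    Tendsto (fun m => S2T T s (u m) (v m)) atTop (𝓝 (S2T T s u₀ v₀)) := by
  have hp : Tendsto (fun m => (u m, v m)) atTop (𝓝 (u₀, v₀)) := hu.prodMk_nhds hv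
  have hc := continuous_S2T T s
  have h := (hc.tendsto (u₀, v₀)).comp hp
  exact h

/-- **Non-triviality is witnessed by a compactly supported real time-separated pair.** If `T.IsNontrivial s` then
some real `u` (negative times), `v` (positive times), BOTH compactly supported, have `𝔖₂ᵀ(u ⊗ v) ≠ 0`: cut the real
time-separated witness of `exists_truncated_ne_zero_of_isNontrivial` off with bumps (supports shrink, so the time
separation survives) and use continuity. [folklore] -/
theorem exists_compact_truncated_ne_zero_of_isNontrivial (T : OSData ι 4) (s : ι) (hT : T.IsNontrivial s) :
    ∃ u v : 𝓢(E⁴, ℝ), tsupport (u : E⁴ → ℝ) ⊆ {z | z 0 < 0} ∧ tsupport (v : E⁴ → ℝ) ⊆ {z | 0 < z 0} ∧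
      HasCompactSupport (u : E⁴ → ℝ) ∧ HasCompactSupport (v : E⁴ → ℝ) ∧ S2T T s u v ≠ 0 := by
  obtain ⟨u₀, v₀, hu₀, hv₀, hne⟩ := exists_truncated_ne_zero_of_isNontrivial T s hT
  obtain ⟨u, hu, hulim⟩ := exists_tsupport_subset_inter_closedBall_tendsto u₀
  obtain ⟨v, hv, hvlim⟩ := exists_tsupport_subset_inter_closedBall_tendsto v₀
  have hlim := tendsto_S2T T s hulim hvlim
  obtain ⟨m, hm⟩ := (hlim.eventually (isOpen_ne.mem_nhds hne)).exists
  refine ⟨u m, v m, (hu m).trans (Set.inter_subset_left.trans hu₀),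
    (hv m).trans (Set.inter_subset_left.trans hv₀), ?_, ?_, hm⟩
  · exact IsCompact.of_isClosed_subset (isCompact_closedBall (0 : E⁴) _) (isClosed_tsupport _)
      ((hu m).trans Set.inter_subset_right)
  · exact IsCompact.of_isClosed_subset (isCompact_closedBall (0 : E⁴) _) (isClosed_tsupport _)
      ((hv m).trans Set.inter_subset_right)

end Continuity

/-! ## §2 Rigidity forbids a blow-up of any admissible pair -/

section NoBlowUp

variable {G : Type} [Group G] [TopologicalSpace G] [IsTopologicalGroup G] [CompactSpace G]
  [MeasurableSpace G] [BorelSpace G]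

/-- **Pinning transfers boundedness.** If OS data tied to `sch` by `IsYangMillsFor` are non-trivial in `tr F²`
and the unit-normalised kernels of all COMPACTLY SUPPORTED time-separated real pairs are eventually bounded along
the bare data `(a_k, β_k, L_k)`, then so is the kernel of every time-separated real Schwartz pair: a compact
non-trivial pair `(u, v)` pins `c_k² ≥ |𝔖₂ᵀ(u⊗v)| / (2B)` eventually (`c_k² K_k(u,v) → 𝔖₂ᵀ(u⊗v) ≠ 0`,
`|K_k(u,v)| ≤ B`), and `c_k² K_k(f,g)` converges. [folklore] -/
theorem eventually_abs_kernel_le_of_isYangMillsFor (r : LatticeRep G) (sch : SpeciesScheme (YMSpecies G))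
    (T : OSData (YMSpecies G) 4) (hT : IsYangMillsFor r sch T) (hNT : T.IsNontrivial r.curvature)
    (hbdd : ∀ u v : 𝓢(E⁴, ℝ), tsupport (u : E⁴ → ℝ) ⊆ {z | z 0 < 0} → tsupport (v : E⁴ → ℝ) ⊆ {z | 0 < z 0} →
      HasCompactSupport (u : E⁴ → ℝ) → HasCompactSupport (v : E⁴ → ℝ) →
        ∃ B : ℝ, ∀ᶠ k in atTop, |twoPointKernel r.ρ (sch.a k) (sch.β k) (sch.L k) u v| ≤ B)
    {f g : 𝓢(E⁴, ℝ)} (hf : tsupport (f : E⁴ → ℝ) ⊆ {z | z 0 < 0}) (hg : tsupport (g : E⁴ → ℝ) ⊆ {z | 0 < z 0}) :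
    ∃ B' : ℝ, ∀ᶠ k in atTop, |twoPointKernel r.ρ (sch.a k) (sch.β k) (sch.L k) f g| ≤ B' := by
  obtain ⟨u, v, hu, hv, huc, hvc, hne⟩ := exists_compact_truncated_ne_zero_of_isNontrivial T r.curvature hNT
  obtain ⟨B, hB⟩ := hbdd u v hu hv huc hvc
  have huv : IsOffDiagonal (T2 u v) := isOffDiagonal_T2 hu hv
  have hfg : IsOffDiagonal (T2 f g) := isOffDiagonal_T2 hf hg
  -- the two limits
  have hKuv := tendsto_c_sq_mul_kernel r sch T hT huv
  have hKfg := tendsto_c_sq_mul_kernel r sch T hT hfg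
  set L : ℂ := S2T T r.curvature u v with hL
  set L' : ℂ := S2T T r.curvature f g with hL'
  have hLpos : 0 < ‖L‖ := norm_pos_iff.2 hne
  -- eventually ‖c² K(u,v)‖ ≥ ‖L‖/2 and ‖c² K(f,g)‖ ≤ ‖L'‖ + 1
  have h1 : ∀ᶠ k in atTop, ‖L‖ / 2 ≤ |(sch.c r.curvature k) ^ 2 *
      twoPointKernel r.ρ (sch.a k) (sch.β k) (sch.L k) u v| := by
    have hball := hKuv.eventually (Metric.ball_mem_nhds L (half_pos hLpos))
    filter_upwards [hball] with k hk
    rw [dist_eq_norm] at hk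
    have htri : ‖L‖ ≤ ‖(((sch.c r.curvature k) ^ 2 *
        twoPointKernel r.ρ (sch.a k) (sch.β k) (sch.L k) u v : ℝ) : ℂ)‖ +
        ‖(((sch.c r.curvature k) ^ 2 * twoPointKernel r.ρ (sch.a k) (sch.β k) (sch.L k) u v : ℝ) : ℂ) - L‖ :=
      norm_le_insert _ _
    rw [Complex.norm_real, Real.norm_eq_abs] at htri
    linarith
  have h2 : ∀ᶠ k in atTop, |(sch.c r.curvature k) ^ 2 *
      twoPointKernel r.ρ (sch.a k) (sch.β k) (sch.L k) f g| ≤ ‖L'‖ + 1 := by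
    have hball := hKfg.eventually (Metric.ball_mem_nhds L' one_pos)
    filter_upwards [hball] with k hk
    rw [dist_eq_norm] at hk
    have htri : ‖(((sch.c r.curvature k) ^ 2 *
        twoPointKernel r.ρ (sch.a k) (sch.β k) (sch.L k) f g : ℝ) : ℂ)‖ ≤ ‖L'‖ +
        ‖(((sch.c r.curvature k) ^ 2 * twoPointKernel r.ρ (sch.a k) (sch.β k) (sch.L k) f g : ℝ) : ℂ) - L'‖ :=
      norm_le_insert' _ _
    rw [Complex.norm_real, Real.norm_eq_abs] at htri
    linarith
  refine ⟨(‖L'‖ + 1) * (2 * max B 1 / ‖L‖), ?_⟩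
  filter_upwards [h1, h2, hB] with k hk1 hk2 hkB
  set c2 : ℝ := (sch.c r.curvature k) ^ 2 with hc2
  set Kuv : ℝ := twoPointKernel r.ρ (sch.a k) (sch.β k) (sch.L k) u v with hKuv_def
  set Kfg : ℝ := twoPointKernel r.ρ (sch.a k) (sch.β k) (sch.L k) f g with hKfg_def
  have hc2nn : 0 ≤ c2 := by rw [hc2]; positivity
  have hB1 : |Kuv| ≤ max B 1 := hkB.trans (le_max_left _ _)
  have hmaxpos : 0 < max B 1 := lt_of_lt_of_le one_pos (le_max_right _ _)
  -- pin c² from below: ‖L‖/2 ≤ c² |Kuv| ≤ c² max B 1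
  have hpin : ‖L‖ / 2 ≤ c2 * max B 1 := by
    rw [abs_mul, abs_of_nonneg hc2nn] at hk1
    exact hk1.trans (mul_le_mul_of_nonneg_left hB1 hc2nn)
  have hc2pos : 0 < c2 := by
    by_contra h0
    have : c2 = 0 := le_antisymm (not_lt.1 h0) hc2nn
    rw [this, zero_mul] at hpin
    linarith
  -- |Kfg| = |c² Kfg| / c² ≤ (‖L'‖+1) / c² ≤ (‖L'‖+1) · (2 max B 1 / ‖L‖)
  have hinv : c2⁻¹ ≤ 2 * max B 1 / ‖L‖ := by
    rw [inv_le_iff_one_le_mul₀ hc2pos, div_mul_eq_mul_div, one_le_div hLpos]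
    linarith
  rw [abs_mul, abs_of_nonneg hc2nn] at hk2
  calc |Kfg| = c2⁻¹ * (c2 * |Kfg|) := by field_simp
    _ ≤ c2⁻¹ * (‖L'‖ + 1) := mul_le_mul_of_nonneg_left hk2 (inv_nonneg.2 hc2nn)
    _ ≤ (2 * max B 1 / ‖L‖) * (‖L'‖ + 1) :=
        mul_le_mul_of_nonneg_right hinv (by positivity)
    _ = (‖L'‖ + 1) * (2 * max B 1 / ‖L‖) := by ring

end NoBlowUp

/-! ## §3 Necessary condition (V) of (A) and the negative lemma -/

/-- **Necessary condition (V) of (A): no admissible pair blows up.** Under `ContinuumLimitOnTrajectory`, along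
every sequence of its hypothesis block: if the unit-normalised curvature two-point kernels
`K_{a_k,β_k,L_k}(u, v)` of all compactly supported time-separated real pairs are eventually bounded, then the
kernel of EVERY time-separated real Schwartz pair is eventually bounded. A statement about Wilson lattice
expectations alone (no renormalisation constant, no OS datum). Its failure along a slow-volume admissible scheme
is the torus-seam mechanism. [folklore] -/
theorem continuumLimitOnTrajectory_imp_noKernelBlowUp (h : ContinuumLimitOnTrajectory) :
    ∀ (G : Type) [Group G] [TopologicalSpace G] [IsTopologicalGroup G] [CompactSpace G],
      IsCompactSimpleLieGroup G →
        letI : MeasurableSpace G := borel G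
        haveI : BorelSpace G := ⟨rfl⟩
        ∀ r : LatticeRep G, ∃ M₀ : ℕ, ∀ M : ℕ, M₀ ≤ M → 2 ≤ M → ∃ θ₀ : ℝ, 0 < θ₀ ∧
          ∀ (θ Δ : ℝ) (sch : SpeciesScheme (YMSpecies G)) (n : ℕ → ℕ), 0 < θ → θ < θ₀ → 0 < Δ →
          (∀ k, sch.a k = ((M : ℝ) ^ n k)⁻¹) → Tendsto sch.β atTop atTop →
          (∀ t : ℕ, 0 < t → ∃ c : ℝ, Tendsto (fun k => ((M : ℝ) ^ n k) ^ 8 *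
            latticeConnectedCorr r.ρ (sch.β k) (sch.side k) r.curvature.F r.curvature.F (t * M ^ n k))
              atTop (𝓝 c)) →
          Tendsto (fun k => ((M : ℝ) ^ n k) ^ 8 *
            latticeConnectedCorr r.ρ (sch.β k) (sch.side k) r.curvature.F r.curvature.F (M ^ n k))
              atTop (𝓝 θ) →
          HasLatticeMassGap r sch Δ →
          (∀ u v : 𝓢(E⁴, ℝ), tsupport (u : E⁴ → ℝ) ⊆ {z | z 0 < 0} → tsupport (v : E⁴ → ℝ) ⊆ {z | 0 < z 0} →
            HasCompactSupport (u : E⁴ → ℝ) → HasCompactSupport (v : E⁴ → ℝ) →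
              ∃ B : ℝ, ∀ᶠ k in atTop, |twoPointKernel r.ρ (sch.a k) (sch.β k) (sch.L k) u v| ≤ B) →
          ∀ f g : 𝓢(E⁴, ℝ), tsupport (f : E⁴ → ℝ) ⊆ {z | z 0 < 0} → tsupport (g : E⁴ → ℝ) ⊆ {z | 0 < z 0} →
            ∃ B' : ℝ, ∀ᶠ k in atTop, |twoPointKernel r.ρ (sch.a k) (sch.β k) (sch.L k) f g| ≤ B' := by
  intro G _ _ _ _ hG r
  letI : MeasurableSpace G := borel G
  haveI : BorelSpace G := ⟨rfl⟩
  obtain ⟨M₀, hM₀⟩ := h G hG r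
  refine ⟨M₀, fun M hM h2 => ?_⟩
  obtain ⟨θ₀, hθ₀, hθ⟩ := hM₀ M hM h2
  refine ⟨θ₀, hθ₀, fun θ Δ sch n h0 h1 hΔ ha hb hc hd he hbdd f g hf hg => ?_⟩
  obtain ⟨sch', ha', hβ', hL', T, hYM, hNT, -⟩ := hθ θ Δ sch n h0 h1 hΔ ha hb hc hd he
  have hbdd' : ∀ u v : 𝓢(E⁴, ℝ), tsupport (u : E⁴ → ℝ) ⊆ {z | z 0 < 0} →
      tsupport (v : E⁴ → ℝ) ⊆ {z | 0 < z 0} → HasCompactSupport (u : E⁴ → ℝ) → HasCompactSupport (v : E⁴ → ℝ) →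
        ∃ B : ℝ, ∀ᶠ k in atTop, |twoPointKernel r.ρ (sch'.a k) (sch'.β k) (sch'.L k) u v| ≤ B := by
    intro u v hu hv huc hvc
    simpa only [ha', hβ', hL'] using hbdd u v hu hv huc hvc
  have key := eventually_abs_kernel_le_of_isYangMillsFor r sch' T hYM hNT hbdd' hf hg
  simpa only [ha', hβ', hL'] using key

/-- **The kernel blow-up hypothesis `H`** (precise; NOT constructible in the tree today). Some compact simple `G`,
lattice representation `r`, cofinally many block factors `M ≥ 2` and, for every window `θ₀ > 0`, an ADMISSIBLE
sequence of (A)'s hypothesis block (`M`-adic shape, `β_k → ∞`, convergent towers, tuning `θ ∈ (0, θ₀)`, uniform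
lattice gap `Δ > 0`) along which the unit-normalised curvature two-point kernels of compactly supported
time-separated real pairs stay bounded while ONE time-separated real Schwartz pair has `|K_k(f, g)| → ∞`. The
torus-seam report derives it for every slow-volume admissible scheme (`liminf log(a_k L_k)/log a_k⁻¹ = 0`) from the
slab susceptibility `χ_k ≳ β_k^{-2}` and a bulk bound; an admissible scheme at all is an instance of (S)+(B) at weak
coupling (open). -/
def KernelBlowUp : Prop :=
  ∃ (G : Type) (_ : Group G) (_ : TopologicalSpace G) (_ : IsTopologicalGroup G) (_ : CompactSpace G),
    IsCompactSimpleLieGroup G ∧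
      letI : MeasurableSpace G := borel G
      haveI : BorelSpace G := ⟨rfl⟩
      ∃ r : LatticeRep G, ∀ M₀ : ℕ, ∃ M : ℕ, M₀ ≤ M ∧ 2 ≤ M ∧ ∀ θ₀ : ℝ, 0 < θ₀ →
        ∃ (θ Δ : ℝ) (sch : SpeciesScheme (YMSpecies G)) (n : ℕ → ℕ), 0 < θ ∧ θ < θ₀ ∧ 0 < Δ ∧
          (∀ k, sch.a k = ((M : ℝ) ^ n k)⁻¹) ∧ Tendsto sch.β atTop atTop ∧
          (∀ t : ℕ, 0 < t → ∃ c : ℝ, Tendsto (fun k => ((M : ℝ) ^ n k) ^ 8 *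
            latticeConnectedCorr r.ρ (sch.β k) (sch.side k) r.curvature.F r.curvature.F (t * M ^ n k))
              atTop (𝓝 c)) ∧
          Tendsto (fun k => ((M : ℝ) ^ n k) ^ 8 *
            latticeConnectedCorr r.ρ (sch.β k) (sch.side k) r.curvature.F r.curvature.F (M ^ n k))
              atTop (𝓝 θ) ∧
          HasLatticeMassGap r sch Δ ∧
          (∀ u v : 𝓢(E⁴, ℝ), tsupport (u : E⁴ → ℝ) ⊆ {z | z 0 < 0} → tsupport (v : E⁴ → ℝ) ⊆ {z | 0 < z 0} →
            HasCompactSupport (u : E⁴ → ℝ) → HasCompactSupport (v : E⁴ → ℝ) →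
              ∃ B : ℝ, ∀ᶠ k in atTop, |twoPointKernel r.ρ (sch.a k) (sch.β k) (sch.L k) u v| ≤ B) ∧
          ∃ f g : 𝓢(E⁴, ℝ), tsupport (f : E⁴ → ℝ) ⊆ {z | z 0 < 0} ∧ tsupport (g : E⁴ → ℝ) ⊆ {z | 0 < z 0} ∧
            Tendsto (fun k => |twoPointKernel r.ρ (sch.a k) (sch.β k) (sch.L k) f g|) atTop atTop

/-- **`¬ ContinuumLimitOnTrajectory` modulo the kernel blow-up hypothesis.** Under `H` the crux (A) as typed is
false: (A)'s necessary condition (V) (`continuumLimitOnTrajectory_imp_noKernelBlowUp`) bounds the blowing-up pair.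
Classification: refuted-MISSTATED modulo `H` — the witness `H` lives on slow-volume schemes only; repair (A) by the
volume-growth clause (`ContinuumLimitOnTrajectoryPVG`, …DefsF), which every line of the crux already threads. -/
theorem continuumLimitOnTrajectory_false_of_kernelBlowUp (hH : KernelBlowUp) : ¬ ContinuumLimitOnTrajectory := by
  intro hA
  obtain ⟨G, _, _, _, _, hG, r, hr⟩ := hH
  letI : MeasurableSpace G := borel G
  haveI : BorelSpace G := ⟨rfl⟩
  obtain ⟨M₀, hM₀⟩ := continuumLimitOnTrajectory_imp_noKernelBlowUp hA G hG r
  obtain ⟨M, hM, h2, hwin⟩ := hr M₀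
  obtain ⟨θ₀, hθ₀, hθ⟩ := hM₀ M hM h2
  obtain ⟨θ, Δ, sch, n, h0, h1, hΔ, ha, hb, hc, hd, he, hbdd, f, g, hf, hg, hblow⟩ := hwin θ₀ hθ₀
  obtain ⟨B', hB'⟩ := hθ θ Δ sch n h0 h1 hΔ ha hb hc hd he hbdd f g hf hg
  obtain ⟨k, hk1, hk2⟩ := (hB'.and (hblow.eventually_gt_atTop B')).exists
  exact absurd hk1 (not_le.2 hk2)

end

end Summit.QuantumFields.YangMills.Theorems.ContinuumLimitOnTrajectory.Negative
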